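import Literature.Analysis.FluidPDE.RusinSverakLerayWeakStrong
import Literature.Analysis.FluidPDE.RusinSverakKatoBoundHolds
import Literature.Analysis.FluidPDE.LocalEnergyExtension
import Literature.Analysis.FluidPDE.LocalLerayWeakStrongProofs
import Literature.Analysis.FluidPDE.RusinSverakSingularPointsStableThreeLeaves
import HarnessLib

/-!
# Rusin–Šverák, Cor. 4.2, over the five remaining leaves of its cone

Analysis/FluidPDE proof file (no definitions, no named facts) for the named fact
`Literature.Analysis.FluidPDE.rusin_sverak_weak_limit_of_singular_points`
(`RusinSverakWeakStability.lean`; W. Rusin, V. Šverák, *Minimal initial data for potential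
Navier–Stokes singularities*, J. Funct. Anal. 260 (2011) 879–891 = arXiv:0911.0500, **Cor. 4.2**
p. 8: for data `u₀^k` bounded in `Ḣ^{1/2}` converging weakly to `u₀`, whose solutions have the
common maximal time `T` with singular points `(x_k, T)`, `x_k` bounded, the weak limit `u₀`
has `T_max(u₀) ≤ T` — transcribed on the Kato side as `¬ HasGlobalKatoSolution 1 u₀`).

This file supersedes `RusinSverakWeakStabilitySixLeaves.lean` (same author) after two landings
in the cone:

* **E needs F2 only.** `leray_solution_exists_of_memLp_three_of_extension :
  localEnergySolution_extension_of_memE2 → leray_solution_exists_of_memLp_three`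
  (`LocalEnergyExtension.lean`, 2026-08-15): for `L³` data the local stage of
  Lemarié-Rieusset's Thm. 14.8 is Kato's mild solution (`kato_local_holds`, Thm. 15.1 (A)
  `kato_isLocalLeraySolutionOn_holds`), so the `E²` local existence theorem **F1**
  `localEnergySolution_exists_local_of_memE2` (Seregin 2014, Prop. 1.8 = Lemarié-Rieusset 2016,
  Thm. 14.1) drops out of the cone of Cor. 4.2; the migration
  `leray_solution_exists_of_memLp_three_of_memE2 (localLeraySolution_exists_of_memE2_of_extension h₁ h₂)
  ↦ leray_solution_exists_of_memLp_three_of_extension h₂` requested in that file's module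
  docstring is carried out here.
* **S needs three leaves.** `rusin_sverak_leray_singular_points_stable_of_three_leaves :
  jia_sverak_2013_lemma_2 → jia_sverak_2013_lemma_8 → localLeray_limit_isLocalLeraySolution → S`
  (`RusinSverakSingularPointsStableThreeLeaves.lean`), Lemma 2.1, the backward-cylinder bridge,
  Prop. 2.2 and the Robinson–Rodrigo–Sadowski ε-regularity inputs being theorems.

Composing with the accepted glue
`rusin_sverak_weak_limit_of_singular_points_of_local_leray_theory : E → U → A → R → S → Cor. 4.2`
(`RusinSverakLerayWeakStrong.lean`; **A** = `kato_isLocalLeraySolutionOn_holds`,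
**R** = `kato_solution_le_div_sqrt_holds`, **U** ⇐ **U₁** by
`local_leray_weak_strong_uniqueness_of`, `LocalLerayWeakStrongProofs.lean`):

* `rusin_sverak_weak_limit_of_singular_points_of_five_leaves :
    localEnergySolution_extension_of_memE2 → local_leray_difference_energy_estimate →
    jia_sverak_2013_lemma_2 → jia_sverak_2013_lemma_8 → localLeray_limit_isLocalLeraySolution →
    rusin_sverak_weak_limit_of_singular_points`,

i.e. the trust base of Cor. 4.2 is exactly five printed results, each vendored with its own
locator and owned by its own unit — the extension step of Lemarié-Rieusset's Thm. 14.8 /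
Kikuchi–Seregin (**F2**), the difference energy estimate of Lemarié-Rieusset's Thm. 14.7 (**U₁**),
Jia–Šverák 2013 Lemma 2 (= Rusin–Šverák Lemma 4.1) and Lemma 8, and the identification of the
limit of local Leray solutions (the limit step of Rusin–Šverák's Thm. 4.2 / Jia–Šverák's Thm. 1) —
and `rusin_sverak_weak_limit_of_singular_points_holds` is this theorem applied to their five
`_holds` once they exist. Also recorded: the four Leray-theory inputs **E ∧ W ∧ R ∧ S** of the
original glue `rusin_sverak_weak_limit_of_singular_points_of_leray_theory`
(`RusinSverakLeraySolutions.lean`) over the same five leaves (`leray_theory_inputs_of_five_leaves`),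
for the other consumers of E/W/S (Cor. 4.3, the weak-limit blow-up). Nothing is asserted here.

## Mathlib / tree search

Tree (all used): `rusin_sverak_weak_limit_of_singular_points_of_local_leray_theory`,
`leray_solution_ae_eq_kato_of_local_leray_theory` (`RusinSverakLerayWeakStrong.lean`),
`leray_solution_exists_of_memLp_three_of_extension` (`LocalEnergyExtension.lean`),
`local_leray_weak_strong_uniqueness_of` (`LocalLerayWeakStrongProofs.lean`),
`kato_isLocalLeraySolutionOn_holds` (`KatoLocalLerayPressureProofs.lean`),
`kato_solution_le_div_sqrt_holds` (`RusinSverakKatoBoundHolds.lean`),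
`rusin_sverak_leray_singular_points_stable_of_three_leaves`
(`RusinSverakSingularPointsStableThreeLeaves.lean`). Nearest existing assemblies:
`rusin_sverak_weak_limit_of_singular_points_of_six_leaves` / `leray_theory_inputs_of_six_leaves`
(`RusinSverakWeakStabilitySixLeaves.lean`, with the superseded hypothesis **F1**); nothing named
`*weak_limit_of_singular_points_of_five_leaves` / `leray_theory_inputs_of_five_leaves`
(`lean search`, 2026-08-15). None of the five leaves has a `_holds` theorem yet (`lean search`).

## References

* W. Rusin, V. Šverák, J. Funct. Anal. 260 (2011) 879–891 = arXiv:0911.0500: §4 p. 6 (Leray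
  solutions exist for every datum; "the only reason for `T_max < ∞` is a singularity"),
  Thm. 4.1 (weak–strong uniqueness), Lemma 4.1, Thm. 4.2, Cor. 4.2 and its proof (p. 8: "Apply
  the theorem, together with Lemma 4.1, Proposition 2.2 and Lemma 2.1"). [RusinSverak2011]
* H. Jia, V. Šverák, SIAM J. Math. Anal. 45 (2013) 1448–1459 = arXiv:1201.1592: Def. 1, Lemma 2,
  Cor. 1, Lemma 8, proof of Thm. 1. [JiaSverak2013]
* P. G. Lemarié-Rieusset, *The Navier–Stokes Problem in the 21st Century* (2016),
  doi:10.1201/b19556: Thm. 14.7 (p. 514), Thm. 14.8 (p. 520), Thm. 15.1 (A)–(C) (p. 565).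
  [LemarieRieusset2016]
-/

noncomputable section

namespace Literature.Analysis.FluidPDE

/-- **Rusin–Šverák, Cor. 4.2, over the five remaining leaves of its cone.** The weak-limit
statement `rusin_sverak_weak_limit_of_singular_points` (data `v₀^k ∈ L³` with bounded, weakly
convergent `Ḣ^{1/2}` classes, Kato solutions on `[0,T)` singular at `(T, x_k)`, `x_k` bounded
⇒ the weak limit has no global Kato solution) follows from the extension step for local energy
solutions with `E²` data (**F2**), the difference energy estimate behind weak–strong uniqueness
(**U₁**), Jia–Šverák's Lemma 2 and Lemma 8, and the identification of the limit of local Leray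
solutions; every other input of the printed argument — existence of the local stage for `L³`
data (Kato, Thm. 15.1 (A): `leray_solution_exists_of_memLp_three_of_extension`), the local Leray
property of Kato solutions **A**, Kato's bound **R**, Prop. 2.2, Lemma 2.1, the backward-cylinder
bridge and ε-regularity — is a theorem of the tree and is plugged in here.
[cite: RusinSverak2011, Cor. 4.2 and its proof (arXiv:0911.0500 p. 8), with §4 p. 6 and Thm. 4.1] -/
theorem rusin_sverak_weak_limit_of_singular_points_of_five_leaves
    (h₂ : localEnergySolution_extension_of_memE2)
    (h₃ : local_leray_difference_energy_estimate)
    (h₄ : jia_sverak_2013_lemma_2) (h₅ : jia_sverak_2013_lemma_8)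
    (h₆ : localLeray_limit_isLocalLeraySolution) :
    rusin_sverak_weak_limit_of_singular_points :=
  rusin_sverak_weak_limit_of_singular_points_of_local_leray_theory
    (leray_solution_exists_of_memLp_three_of_extension h₂)
    (local_leray_weak_strong_uniqueness_of h₃) kato_isLocalLeraySolutionOn_holds
    kato_solution_le_div_sqrt_holds
    (rusin_sverak_leray_singular_points_stable_of_three_leaves h₄ h₅ h₆)

/-- The four Leray-theory inputs **E**, **W**, **R**, **S** of the accepted glue
`rusin_sverak_weak_limit_of_singular_points_of_leray_theory`, jointly, over the same five leaves
(for the other consumers of E/W/S — Cor. 4.3, the weak-limit blow-up); supersedes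
`leray_theory_inputs_of_six_leaves`. [cite: RusinSverak2011, §4 p. 6, Thm. 4.1, Thm. 4.2 with Lemma 2.1 (arXiv:0911.0500 pp. 6–8)] -/
theorem leray_theory_inputs_of_five_leaves
    (h₂ : localEnergySolution_extension_of_memE2)
    (h₃ : local_leray_difference_energy_estimate)
    (h₄ : jia_sverak_2013_lemma_2) (h₅ : jia_sverak_2013_lemma_8)
    (h₆ : localLeray_limit_isLocalLeraySolution) :
    leray_solution_exists_of_memLp_three ∧ leray_solution_ae_eq_kato ∧
      kato_solution_le_div_sqrt ∧ rusin_sverak_leray_singular_points_stable :=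
  ⟨leray_solution_exists_of_memLp_three_of_extension h₂,
    leray_solution_ae_eq_kato_of_local_leray_theory (local_leray_weak_strong_uniqueness_of h₃)
      kato_isLocalLeraySolutionOn_holds,
    kato_solution_le_div_sqrt_holds,
    rusin_sverak_leray_singular_points_stable_of_three_leaves h₄ h₅ h₆⟩

end Literature.Analysis.FluidPDE

end
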